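import Summits.CriticalPhenomena.CardyFormulaZ2.Theorems.CardyFlipRussoQuadrupoleSelectionRuleBitsReduction
import Literature.Probability.RandomPlanarGeometry.ChordalCurveFamily
import HarnessLib

/-!
# Line `stagger-split` for the kernel crux `QuadrupoleSelectionRule` (stmt-CriticalPhenomena-7029),
# route `CardyFlipRusso`, typed proxy `BitsLeg.QuadrupoleSelectionRuleBits` (bits leg L5)

Strategist line (planner-cstrat-stmt-CriticalPhenomena-7029-s1-0, 2026-08-17).  The crux item is
informal; like the lead's line `Sketch` (§R4) this skeleton concludes the TYPED consumed form of the
kernel on the bits leg, `Summit.CriticalPhenomena.CardyFormulaZ2.Theorems.BitsLeg.QuadrupoleSelectionRuleBits`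
(registered with `ledger skeleton check --crux-decl`).

## Idea (exact symmetric-point identity, then a two-term split)

On `Λ = ℤ² ∪ (ℤ² + (½,½))` the translation by `w = (½, −½)` (lattice units) maps `Λ` onto itself,
SWAPS the two sublattices, maps the vertical face `(x, true)` onto the horizontal face `(x, false)`
with the roles of the two diagonals EXCHANGED (the `ℤ²`-diagonal of `(x,true)` becomes the dual
diagonal of `(x,false)`), and hence maps the leg law `legLaw t` to `legLaw (1 − t)` and the forward
flip to the backward flip.  Transporting the whole picture (lattice, colours, domain) gives the exact
identities (`stub_pairIdentity`, `stub_weightIdentity`)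

  `faceResponse R t δ (x,true) = − faceResponse (R + δw) (1−t) δ (x,false)`,
  `armWeight   R t δ (x,true) =   armWeight   (R + δw) (1−t) δ (x,false)`,

so the quarter-turn pair sum of the lead's `PairRate` is, EXACTLY,

  `f_t(h;R) + f_t(v;R) = [f_t(h;R) − f_{1−t}(h;R)] + [f_{1−t}(h;R) − f_{1−t}(h;R+δw)]`.

* The second bracket (`TranslationSensitivity`) compares ONE face's response for the domain and its
  translate by `δ/√2`: bounded by boundary three-arm sensitivity, `≤ C (δ/d) · weight` — RSW
  technology (half-plane 3-arm exponent 2 and 4-arm exponent > 1 are universal given RSW), no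
  selection rule needed.
* The first bracket (`StaggeredRate`) is the sublattice-STAGGERED channel: the response of one face in
  the `t`-environment versus the `(1−t)`-environment.  It vanishes identically at `t = ½`, so the
  kernel AT the symmetric point `t = ½` (first-order response to a `C₄`-symmetric sublattice bias)
  follows from `TranslationSensitivity` + `ArmBudget` alone — the first rigorous-technology instance of
  the selection rule.  For `t ≠ ½` it is the whole open content (no law-preserving isometry reverses a
  flip off `t = ½`: any isometry exchanging the two diagonals of a face swaps the sublattices, and
  `G_s` has degrees 8/4).
* `bits_of_twoSided_armBudget` re-runs the lead's reduction with the budget used at `t` and at `1−t`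
  (`ArmBudget θ` is uniform in `t ∈ [0,1]`).

Stubs: `stub_pairIdentity`, `stub_weightIdentity` (M, provable now: measure transport under the
lattice isometry + box independence `siteConnIn_congr`), `stub_translationSensitivity` (L, RSW
technology), `stub_armBudget` (= the lead's `ArmBudget 1`; NOTE `LayerArm` as typed is false — no
cut-off in the layer — use the cut-off layer sum), `stub_staggeredRate` (the crux proper for `t ≠ ½`).
-/

noncomputable section

open MeasureTheory Filter Topology Set
open scoped BigOperators

namespace Summit.CriticalPhenomena.CardyFormulaZ2.Cruxes.QuadrupoleSelectionRule.StaggerSplit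

open Literature.Probability.LatticeModels Literature.Probability.Percolation
  Literature.Probability.RandomPlanarGeometry
open Summit.CriticalPhenomena.CardyFormulaZ2.Theorems.BitsLeg

/-! ### The half-diagonal shift and the two rates -/

/-- The half-diagonal shift vector `δ · (½ − ½ i)` (translation of `Λ` onto itself swapping the
sublattices `ℤ²` and `ℤ² + (½,½)`). -/
def shiftVec (δ : ℝ) : ℂ := (δ : ℂ) * ((1 / 2 : ℂ) - (1 / 2 : ℂ) * Complex.I)

/-- The translated conformal rectangle `R + δ (½ − ½ i)`. -/
def shiftRect (R : ConformalRectangle) (δ : ℝ) : ConformalRectangle :=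
  MarkedDomain.map R (Homeomorph.addRight (shiftVec δ))

/-- **StaggeredRate θ** — the sublattice-staggered channel: the annealed forward response of ONE
face in the `t`-environment and in the `(1−t)`-environment agree to relative order `(δ/d)^θ`
against the face's own four-arm weights.  Identically true at `t = ½`; for `t ≠ ½` this is the
open content of the kernel on L5.  (Posited; open.) -/
def StaggeredRate (θ : ℝ) : Prop :=
  ∀ R : ConformalRectangle, ∃ C₀ : ℝ, 0 < C₀ ∧ ∃ C : ℝ, 0 ≤ C ∧
    ∀ δ : ℝ, 0 < δ → δ < 1 → ∀ t ∈ Icc (0 : ℝ) 1, ∀ x : ℤ × ℤ, C₀ * δ < depth R δ x →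
      |faceResponse R t δ (x, false) - faceResponse R (1 - t) δ (x, false)| ≤
        C * (δ / depth R δ x) ^ θ *
          (armWeight R t δ (x, false) + armWeight R (1 - t) δ (x, false))

/-- **TranslationSensitivity θ** — the response of ONE face for the domain `R` and for its translate
by `δ (½ − ½ i)` agree to relative order `(δ/d)^θ` against the weights (boundary three-arm
sensitivity; RSW technology).  (Posited; open.) -/
def TranslationSensitivity (θ : ℝ) : Prop :=
  ∀ R : ConformalRectangle, ∃ C₀ : ℝ, 0 < C₀ ∧ ∃ C : ℝ, 0 ≤ C ∧
    ∀ δ : ℝ, 0 < δ → δ < 1 → ∀ t ∈ Icc (0 : ℝ) 1, ∀ x : ℤ × ℤ, C₀ * δ < depth R δ x →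
      |faceResponse R t δ (x, false) - faceResponse (shiftRect R δ) t δ (x, false)| ≤
        C * (δ / depth R δ x) ^ θ *
          (armWeight R t δ (x, false) + armWeight (shiftRect R δ) t δ (x, false))

/-- **TwoSidedPairRate θ** — the lead's `PairRate θ` with the `(1−t)`-weight of the horizontal face
added to the yardstick (what the split naturally gives; the budget absorbs it because `ArmBudget`
is uniform in `t`). -/
def TwoSidedPairRate (θ : ℝ) : Prop :=
  ∀ R : ConformalRectangle, ∃ C₀ : ℝ, 0 < C₀ ∧ ∃ C : ℝ, 0 ≤ C ∧
    ∀ δ : ℝ, 0 < δ → δ < 1 → ∀ t ∈ Icc (0 : ℝ) 1, ∀ x : ℤ × ℤ, C₀ * δ < depth R δ x →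
      |faceResponse R t δ (x, false) + faceResponse R t δ (x, true)| ≤
        C * (δ / depth R δ x) ^ θ *
          (armWeight R t δ (x, false) + armWeight R t δ (x, true) +
            armWeight R (1 - t) δ (x, false))

/-! ### Registered stubs

Each stub's statement is the `Prop` `Sig.stub_<name>`; the registered obligation is
`theorem stub_<name> : Sig.stub_<name> := by sorry`; `QuadrupoleSelectionRuleBits_of` takes the five
statements as hypotheses BY NAME. -/

/-- STUB 1 statement (M, provable now).  The exact sublattice-swap identity for the responses:
transporting lattice, colours and domain by `δ (½ − ½ i)` maps the forward flip of `(x,true)` under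
`legLaw t` to the BACKWARD flip of `(x,false)` under `legLaw (1−t)` for the translated rectangle
(`flipResponse_flipGraph`, `gamma_insert_eq_flipGraph`, invariance of `sitePercolation V half` and of
`prodBernoulli` under the induced coordinate bijections, box independence `siteConnIn_congr`). -/
def Sig.stub_pairIdentity : Prop :=
  ∀ (R : ConformalRectangle) (t δ : ℝ) (x : ℤ × ℤ), 0 < δ → t ∈ Icc (0 : ℝ) 1 →
    faceResponse R t δ (x, true) = - faceResponse (shiftRect R δ) (1 - t) δ (x, false)

/-- STUB 2 statement (M, provable now).  The same transport for the four-arm weights (created and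
destroyed events are exchanged, their sum is not). -/
def Sig.stub_weightIdentity : Prop :=
  ∀ (R : ConformalRectangle) (t δ : ℝ) (x : ℤ × ℤ), 0 < δ → t ∈ Icc (0 : ℝ) 1 →
    armWeight R t δ (x, true) = armWeight (shiftRect R δ) (1 - t) δ (x, false)

/-- STUB 3 statement (the crux proper for `t ≠ ½`; trivially true at `t = ½`). -/
def Sig.stub_staggeredRate : Prop := StaggeredRate 1

/-- STUB 4 statement (L, RSW technology: annealed RSW along the leg, arm separation, half-plane
three-arm exponent `2`, four-arm exponent `> 1`). -/
def Sig.stub_translationSensitivity : Prop := TranslationSensitivity 1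

/-- STUB 5 statement (= the lead's `ArmBudget 1`: annealed RSW + four-arm exponent `> 1` in the bulk,
CUT-OFF layer sum near the boundary). -/
def Sig.stub_armBudget : Prop := ArmBudget 1

/-- STUB 1. -/
theorem stub_pairIdentity : Sig.stub_pairIdentity := by
  sorry

/-- STUB 2. -/
theorem stub_weightIdentity : Sig.stub_weightIdentity := by
  sorry

/-- STUB 3. -/
theorem stub_staggeredRate : Sig.stub_staggeredRate := by
  sorry

/-- STUB 4. -/
theorem stub_translationSensitivity : Sig.stub_translationSensitivity := by
  sorry

/-- STUB 5. -/
theorem stub_armBudget : Sig.stub_armBudget := by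
  sorry

/-! ### Glue (sorry-free) -/

/-- The split: identities + staggered rate + translation sensitivity give the two-sided pair rate. -/
theorem twoSided_of_split (θ : ℝ)
    (hI : ∀ (R : ConformalRectangle) (t δ : ℝ) (x : ℤ × ℤ), 0 < δ → t ∈ Icc (0 : ℝ) 1 →
      faceResponse R t δ (x, true) = - faceResponse (shiftRect R δ) (1 - t) δ (x, false))
    (hW : ∀ (R : ConformalRectangle) (t δ : ℝ) (x : ℤ × ℤ), 0 < δ → t ∈ Icc (0 : ℝ) 1 →
      armWeight R t δ (x, true) = armWeight (shiftRect R δ) (1 - t) δ (x, false))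
    (hS : StaggeredRate θ) (hT : TranslationSensitivity θ) : TwoSidedPairRate θ := by
  intro R
  obtain ⟨C₀, hC₀, C, hC, hs⟩ := hS R
  obtain ⟨C₀', hC₀', C', hC', ht'⟩ := hT R
  refine ⟨max C₀ C₀', lt_max_of_lt_left hC₀, C + C', add_nonneg hC hC', ?_⟩
  intro δ hδ hδ1 t ht x hx
  have h1t : 1 - t ∈ Icc (0 : ℝ) 1 := ⟨by linarith [ht.2], by linarith [ht.1]⟩
  have hx0 : C₀ * δ < depth R δ x := lt_of_le_of_lt (mul_le_mul_of_nonneg_right (le_max_left _ _) hδ.le) hx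
  have hx1 : C₀' * δ < depth R δ x := lt_of_le_of_lt (mul_le_mul_of_nonneg_right (le_max_right _ _) hδ.le) hx
  have hd : 0 < depth R δ x := lt_trans (mul_pos hC₀ hδ) hx0
  have hr : 0 ≤ (δ / depth R δ x) ^ θ := Real.rpow_nonneg (div_nonneg hδ.le hd.le) θ
  have hA := hs δ hδ hδ1 t ht x hx0
  have hB := ht' δ hδ hδ1 (1 - t) h1t x hx1
  have hIx := hI R t δ x hδ ht
  have hWx := hW R t δ x hδ ht
  have w0 := armWeight_nonneg R t δ (x, false)
  have w1 := armWeight_nonneg R t δ (x, true)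
  have w2 := armWeight_nonneg R (1 - t) δ (x, false)
  have key : faceResponse R t δ (x, false) + faceResponse R t δ (x, true) =
      (faceResponse R t δ (x, false) - faceResponse R (1 - t) δ (x, false)) +
        (faceResponse R (1 - t) δ (x, false) - faceResponse (shiftRect R δ) (1 - t) δ (x, false)) := by
    rw [hIx]; ring
  rw [key]
  calc |(faceResponse R t δ (x, false) - faceResponse R (1 - t) δ (x, false)) +
        (faceResponse R (1 - t) δ (x, false) - faceResponse (shiftRect R δ) (1 - t) δ (x, false))|
      ≤ |faceResponse R t δ (x, false) - faceResponse R (1 - t) δ (x, false)| +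
        |faceResponse R (1 - t) δ (x, false) - faceResponse (shiftRect R δ) (1 - t) δ (x, false)| :=
        abs_add_le _ _
    _ ≤ C * (δ / depth R δ x) ^ θ * (armWeight R t δ (x, false) + armWeight R (1 - t) δ (x, false)) +
        C' * (δ / depth R δ x) ^ θ *
          (armWeight R (1 - t) δ (x, false) + armWeight (shiftRect R δ) (1 - t) δ (x, false)) :=
        add_le_add hA hB
    _ = C * (δ / depth R δ x) ^ θ * (armWeight R t δ (x, false) + armWeight R (1 - t) δ (x, false)) +
        C' * (δ / depth R δ x) ^ θ * (armWeight R (1 - t) δ (x, false) + armWeight R t δ (x, true)) := by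
        rw [← hWx]
    _ ≤ (C + C') * (δ / depth R δ x) ^ θ *
          (armWeight R t δ (x, false) + armWeight R t δ (x, true) + armWeight R (1 - t) δ (x, false)) := by
        have e1 : 0 ≤ C * (δ / depth R δ x) ^ θ := mul_nonneg hC hr
        have e2 : 0 ≤ C' * (δ / depth R δ x) ^ θ := mul_nonneg hC' hr
        nlinarith [mul_nonneg e1 w1, mul_nonneg e2 w0]

/-- The pair bound with cut-off, two-sided version of the lead's `abs_pair_le_cutoff`. -/
theorem abs_pair_le_cutoff_twoSided (R : ConformalRectangle) {θ C₀ C δ t : ℝ} (hC₀ : 0 < C₀)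
    (hδ : 0 < δ)
    (hpair : ∀ x : ℤ × ℤ, C₀ * δ < depth R δ x →
      |faceResponse R t δ (x, false) + faceResponse R t δ (x, true)| ≤
        C * (δ / depth R δ x) ^ θ *
          (armWeight R t δ (x, false) + armWeight R t δ (x, true) + armWeight R (1 - t) δ (x, false)))
    (x : ℤ × ℤ) :
    |faceResponse R t δ (x, false) + faceResponse R t δ (x, true)| ≤
      max 1 (C * C₀⁻¹ ^ θ) * cutoff C₀ θ δ (depth R δ x) *
        (armWeight R t δ (x, false) + armWeight R t δ (x, true) + armWeight R (1 - t) δ (x, false)) := by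
  have hw0 := armWeight_nonneg R t δ (x, false)
  have hw1 := armWeight_nonneg R t δ (x, true)
  have hw2 := armWeight_nonneg R (1 - t) δ (x, false)
  by_cases h : depth R δ x ≤ C₀ * δ
  · have hcut : cutoff C₀ θ δ (depth R δ x) = 1 := by simp [cutoff, h]
    rw [hcut, mul_one]
    calc |faceResponse R t δ (x, false) + faceResponse R t δ (x, true)|
        ≤ |faceResponse R t δ (x, false)| + |faceResponse R t δ (x, true)| := abs_add_le _ _
      _ ≤ armWeight R t δ (x, false) + armWeight R t δ (x, true) :=
          add_le_add (abs_faceResponse_le_armWeight R t δ _) (abs_faceResponse_le_armWeight R t δ _)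
      _ ≤ armWeight R t δ (x, false) + armWeight R t δ (x, true) + armWeight R (1 - t) δ (x, false) :=
          le_add_of_nonneg_right hw2
      _ = 1 * (armWeight R t δ (x, false) + armWeight R t δ (x, true) +
            armWeight R (1 - t) δ (x, false)) := (one_mul _).symm
      _ ≤ max 1 (C * C₀⁻¹ ^ θ) * (armWeight R t δ (x, false) + armWeight R t δ (x, true) +
            armWeight R (1 - t) δ (x, false)) :=
          mul_le_mul_of_nonneg_right (le_max_left _ _) (add_nonneg (add_nonneg hw0 hw1) hw2)
  · push Not at h
    have hd : 0 < depth R δ x := lt_trans (mul_pos hC₀ hδ) h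
    have hcut : cutoff C₀ θ δ (depth R δ x) = (C₀ * δ / depth R δ x) ^ θ := by
      simp [cutoff, not_le.2 h]
    have hsplit : (δ / depth R δ x) ^ θ = C₀⁻¹ ^ θ * (C₀ * δ / depth R δ x) ^ θ := by
      rw [← Real.mul_rpow (inv_nonneg.2 hC₀.le) (div_nonneg (mul_pos hC₀ hδ).le hd.le)]
      congr 1
      field_simp
    calc |faceResponse R t δ (x, false) + faceResponse R t δ (x, true)|
        ≤ C * (δ / depth R δ x) ^ θ *
            (armWeight R t δ (x, false) + armWeight R t δ (x, true) + armWeight R (1 - t) δ (x, false)) :=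
          hpair x h
      _ = (C * C₀⁻¹ ^ θ) * cutoff C₀ θ δ (depth R δ x) *
            (armWeight R t δ (x, false) + armWeight R t δ (x, true) + armWeight R (1 - t) δ (x, false)) := by
          rw [hcut, hsplit]; ring
      _ ≤ max 1 (C * C₀⁻¹ ^ θ) * cutoff C₀ θ δ (depth R δ x) *
            (armWeight R t δ (x, false) + armWeight R t δ (x, true) + armWeight R (1 - t) δ (x, false)) := by
          apply mul_le_mul_of_nonneg_right _ (add_nonneg (add_nonneg hw0 hw1) hw2)
          exact mul_le_mul_of_nonneg_right (le_max_right _ _) (cutoff_nonneg C₀ θ δ _ hC₀ hδ)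

/-- **Reduction, two-sided.**  `TwoSidedPairRate θ → ArmBudget θ → QuadrupoleSelectionRuleBits`: the
lead's reduction with the arm budget used at `t` and at `1 − t`. -/
theorem bits_of_twoSided_armBudget (θ : ℝ) (hP : TwoSidedPairRate θ) (hA : ArmBudget θ) :
    ∀ R : ConformalRectangle, ∃ η : ℝ → ℝ, Tendsto η (𝓝[>] 0) (𝓝 0) ∧
      ∀ δ : ℝ, 0 < δ → δ < 1 → ∀ t ∈ Icc (0 : ℝ) 1, |flipSum R t δ| ≤ η δ := by
  intro R
  obtain ⟨C₀, hC₀, C, -, hpair⟩ := hP R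
  obtain ⟨η, hη, hbudget⟩ := hA R C₀ hC₀
  set K : ℝ := max 1 (C * C₀⁻¹ ^ θ) with hK
  refine ⟨fun δ => 2 * K * η δ, ?_, fun δ hδ hδ1 t ht => ?_⟩
  · simpa using hη.const_mul (2 * K)
  · have hK0 : 0 ≤ K := le_trans zero_le_one (le_max_left _ _)
    have h1t : 1 - t ∈ Icc (0 : ℝ) 1 := ⟨by linarith [ht.2], by linarith [ht.1]⟩
    have hbt := hbudget δ hδ hδ1 t ht
    have hb1t := hbudget δ hδ hδ1 (1 - t) h1t
    -- the (1 - t)-weights of the horizontal faces are part of the (1 - t)-budget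
    have hdrop : ∑ x ∈ box R δ, cutoff C₀ θ δ (depth R δ x) * armWeight R (1 - t) δ (x, false) ≤
        ∑ k ∈ faces R δ, cutoff C₀ θ δ (depth R δ k.1) * armWeight R (1 - t) δ k := by
      rw [sum_faces_eq_sum_pairs]
      refine Finset.sum_le_sum fun x _ => ?_
      have := mul_nonneg (cutoff_nonneg C₀ θ δ (depth R δ x) hC₀ hδ) (armWeight_nonneg R (1 - t) δ (x, true))
      linarith
    unfold flipSum
    rw [sum_faces_eq_sum_pairs]
    calc |∑ x ∈ box R δ, (faceResponse R t δ (x, false) + faceResponse R t δ (x, true))|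
        ≤ ∑ x ∈ box R δ, |faceResponse R t δ (x, false) + faceResponse R t δ (x, true)| :=
          Finset.abs_sum_le_sum_abs _ _
      _ ≤ ∑ x ∈ box R δ, K * cutoff C₀ θ δ (depth R δ x) *
              (armWeight R t δ (x, false) + armWeight R t δ (x, true) +
                armWeight R (1 - t) δ (x, false)) :=
          Finset.sum_le_sum fun x _ =>
            abs_pair_le_cutoff_twoSided R hC₀ hδ (fun x hx => hpair δ hδ hδ1 t ht x hx) x
      _ = K * ∑ k ∈ faces R δ, cutoff C₀ θ δ (depth R δ k.1) * armWeight R t δ k +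
            K * ∑ x ∈ box R δ, cutoff C₀ θ δ (depth R δ x) * armWeight R (1 - t) δ (x, false) := by
          rw [sum_faces_eq_sum_pairs, Finset.mul_sum, Finset.mul_sum, ← Finset.sum_add_distrib]
          refine Finset.sum_congr rfl fun x _ => ?_
          ring
      _ ≤ K * η δ + K * η δ :=
          add_le_add (mul_le_mul_of_nonneg_left hbt hK0)
            (mul_le_mul_of_nonneg_left (le_trans hdrop hb1t) hK0)
      _ = 2 * K * η δ := by ring

/-- **`QuadrupoleSelectionRuleBits` from the five stubs, BY NAME** (sorry-free composition; this is
the skeleton theorem). -/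
theorem QuadrupoleSelectionRuleBits_of :
    Sig.stub_pairIdentity → Sig.stub_weightIdentity → Sig.stub_staggeredRate →
      Sig.stub_translationSensitivity → Sig.stub_armBudget →
        Summit.CriticalPhenomena.CardyFormulaZ2.Theorems.BitsLeg.QuadrupoleSelectionRuleBits :=
  fun hI hW hS hT hA => bits_of_twoSided_armBudget 1 (twoSided_of_split 1 hI hW hS hT) hA

/-- The kernel on L5 from the registered stubs. -/
theorem QuadrupoleSelectionRuleBits_proof :
    Summit.CriticalPhenomena.CardyFormulaZ2.Theorems.BitsLeg.QuadrupoleSelectionRuleBits :=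
  QuadrupoleSelectionRuleBits_of stub_pairIdentity stub_weightIdentity stub_staggeredRate
    stub_translationSensitivity stub_armBudget

/-- **Special case `t = ½` (the symmetric point), needing NO staggered rate**: the pair sum is a
pure translation difference. -/
theorem pairSum_half_eq (hI : Sig.stub_pairIdentity) (R : ConformalRectangle) {δ : ℝ} (hδ : 0 < δ) (x : ℤ × ℤ) :
    faceResponse R (1 / 2) δ (x, false) + faceResponse R (1 / 2) δ (x, true) =
      faceResponse R (1 / 2) δ (x, false) - faceResponse (shiftRect R δ) (1 / 2) δ (x, false) := by
  have h : (1 : ℝ) / 2 ∈ Icc (0 : ℝ) 1 := ⟨by norm_num, by norm_num⟩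
  rw [hI R (1 / 2) δ x hδ h]
  norm_num
  ring

end Summit.CriticalPhenomena.CardyFormulaZ2.Cruxes.QuadrupoleSelectionRule.StaggerSplit

end
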